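import Summits.NavierStokesRegularity.NavierStokesRegularity.Theses.CoriolisHead
import Summits.NavierStokesRegularity.NavierStokesRegularity.Theorems.FilamentSkeletonRssCoreGluingClassicalOfProfile
import Literature.Analysis.FluidPDE.ChaeWolfRemovingDSSBounds
import Literature.Analysis.FluidPDE.ClassicalSolutionRescale
import Literature.Analysis.FluidPDE.PineauVicolRSSProofs
import Literature.Analysis.FluidPDE.LeraySelfSimilarCalculus
import HarnessLib

/-!
# Route CoriolisHead · crux `NoCoRotatingCore` (stmt-NavierStokesRegularity-22676) —
# UNIFORM gradient bound for rotated self-similar profiles (scale-invariant KNSS smoothing)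

Support file (`--supports stmt-NavierStokesRegularity-22676`; theorems only, no definitions, no named
facts).  The tree so far bounds the gradient of a bounded rotated Leray profile only POLYNOMIALLY in
`|y|` (`CoriolisHeadNoCoRotatingCoreGradientBound`, local elliptic estimates in similarity variables,
where the drift `a y − B y` is unbounded).  Here the bound is made UNIFORM and SCALE-INVARIANT by passing
to physical variables, where the drift disappears:

* `exists_norm_fderiv_le_of_ancient_typeI` — there is an absolute constant `C` such that every
  classical Navier–Stokes solution (`ν = 1`) on `ℝ³ × (−∞, 0)` with the Type-I-IN-TIME bound
  `‖u(t, x)‖ ≤ N/√(−t)` has `‖∇u(−1, x)‖ ≤ C N²` for all `x`.  Proof: the solution is ANCIENT, so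
  the parabolic window of length `2κ²`, `κ² = τ/N²`, ending at `−τ` (`τ < 1 < τ(1 + N⁻²)`) is
  available; the Navier–Stokes rescaling `v(s, y) = κ u(t₀ + κ²s, κy)` (`ClassicalSolutionRescale`)
  is bounded by `1` on `(0, 2) × ℝ³`, hence a bounded weak solution (`ClassicalBoundedWeak`), so
  KNSS 2009 §4 (`KNSS2009_regularity_boundedWeak_window_holds` with `M = 1`, `T = 2`, `δ = 1`)
  bounds `‖∇v(s, ·)‖ ≤ C₁` for a.e. and then — by continuity in `s`, as in
  `ChaeWolf.window_transfer` — every `s ∈ (1, 2)`; the drift `b(s)` of KNSS's Lemma 3.1 is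
  invisible to `∇`.  Undoing the scaling at the time `s₁ ∈ (1, 2)` above `t = −1` gives
  `‖∇u(−1)‖ ≤ C₁/κ² = C₁N²/τ ≤ 2C₁N²`.  No spatial decay, no mildness and no pressure normalisation
  is needed (KNSS's class contains the parasitic solutions `b(t)`).
* `exists_norm_fderiv_le_of_pvProfile` — hence every smooth solution `(V, Q)` of Pineau–Vicol's
  rotated profile system (1.8a) (ANY rotation rate `α`) with `sup |V| ≤ M` has the UNIFORM gradient
  bound `sup ‖DV‖ ≤ C M²`: its ansatz field `pvAnsatz α V` is a classical solution on `(−∞, 0)`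
  (`isClassicalNSSolutionOn_pvAnsatz_of_profile`: the rotating profile `R(αs) V(R(−αs) y)` solves
  the backward Leray system — tree: `classicalOfProfile_isBackwardLeraySolutionOn` — and
  `isClassicalNSSolutionOn_Iio_ofLerayOrbit_iff`)
  with `‖u(t, x)‖ ≤ M/√(−t)` (rotations are isometries) and `u(−1, ·) = V`.

The crux-variable form (any `ν, a > 0`, any skew `B`: `sup ‖DU‖ ≤ C sup|U|²/ν`) and its
consequence, the SMALL-AMPLITUDE LIOUVILLE THEOREM at every rotation rate, are in
`CoriolisHeadNoCoRotatingCoreSmallAmplitude`.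

HONEST FRAMING. Regularity bookkeeping for GIVEN profiles; nothing here proves `NoCoRotatingCore`,
`X`, or Navier–Stokes regularity.

References: G. Koch, N. Nadirashvili, G. Seregin, V. Šverák, Acta Math. 203 (2009) =
arXiv:0709.3599, §4 (4.10) and §1 (scaling) [KochNadirashviliSereginSverak2009]; B. Pineau,
V. Vicol, arXiv:2607.09619 (2026), (1.7)–(1.8), Remark 1.2 [PineauVicol2026]; D. Chae, J. Wolf,
arXiv:1610.09464, §3 (3.6) [ChaeWolf2017RemovingDSS].
-/

noncomputable section

-- the summit and its single sub-problem share the name (CONVENTIONS §1), as in every Theorems file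
set_option linter.dupNamespace false

open Set Function Filter MeasureTheory
open scoped ContDiff Laplacian RealInnerProductSpace Topology
open Literature.Analysis.FluidPDE Literature.Analysis.FluidPDE.PineauVicol2026

namespace Summit.NavierStokesRegularity.NavierStokesRegularity.Theorems.CoriolisHead

/-! ### Scale-invariant gradient bound for Type-I-in-time ancient classical solutions -/

/-- **Scale-invariant KNSS gradient bound for ancient solutions.** There is an absolute constant
`C ≥ 0` such that every classical Navier–Stokes solution (`ν = 1`, no force) on `ℝ³ × (−∞, 0)` with
`‖u(t, x)‖ ≤ N/√(−t)` for all `t < 0` satisfies `‖∇u(−1, x)‖ ≤ C N²` for all `x` (KNSS 2009 (4.10)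
on the rescaled window of length `2τ/N²` ending at `−τ`, `τ < 1 < τ(1 + N⁻²)`, which the ancient
solution provides; the drift of Lemma 3.1 does not see `∇`).
[cite: KochNadirashviliSereginSverak2009, §4 (4.10) (arXiv:0709.3599 p. 8)] -/
theorem exists_norm_fderiv_le_of_ancient_typeI :
    ∃ C : ℝ, 0 ≤ C ∧ ∀ {u : ℝ → (EuclideanSpace ℝ (Fin 3)) → (EuclideanSpace ℝ (Fin 3))} {p : ℝ → (EuclideanSpace ℝ (Fin 3)) → ℝ},
      IsClassicalNSSolutionOn (Iio 0) 1 0 u p → ∀ {N : ℝ},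
      (∀ t < (0 : ℝ), ∀ x, ‖u t x‖ ≤ N / Real.sqrt (-t)) →
      ∀ x, ‖fderiv ℝ (u (-1)) x‖ ≤ C * N ^ 2 := by
  obtain ⟨Cw, Lw, Nw, hwin⟩ := KNSS2009_regularity_boundedWeak_window_holds 1 2 (by norm_num)
  refine ⟨2 * max (Cw 1 1) 0, by positivity, ?_⟩
  intro u p hcl N hN x
  have hN0 : 0 ≤ N := by
    have h := hN (-1) (by norm_num) 0
    rw [neg_neg, Real.sqrt_one, div_one] at h
    exact (norm_nonneg _).trans h
  rcases hN0.eq_or_lt with hN00 | hNpos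
  · -- `N = 0`: the solution vanishes at `t = -1`
    have hu : u (-1) = fun _ => (0 : (EuclideanSpace ℝ (Fin 3))) := by
      funext y
      have h := hN (-1) (by norm_num) y
      rw [← hN00, zero_div] at h
      exact norm_le_zero_iff.1 h
    rw [hu]
    simp only [fderiv_fun_const, Pi.zero_apply, norm_zero]
    positivity
  -- `N > 0`: the window
  set τ : ℝ := (2 * N ^ 2 + 1) / (2 * (N ^ 2 + 1)) with hτ
  have hN2 : 0 < N ^ 2 := by positivity
  have hτpos : 0 < τ := by positivity
  have hτ1 : τ < 1 := by
    rw [hτ, div_lt_one (by positivity)]; linarith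
  have hτhalf : 1 / 2 ≤ τ := by
    rw [hτ, le_div_iff₀ (by positivity)]; linarith
  set κ : ℝ := Real.sqrt τ / N with hκ
  have hκpos : 0 < κ := div_pos (Real.sqrt_pos.2 hτpos) hNpos
  have hκ2 : κ ^ 2 = τ / N ^ 2 := by
    rw [hκ, div_pow, Real.sq_sqrt hτpos.le]
  -- `1 - τ < κ²` (the time `-1` lies in the last half of the window)
  have hτκ : 1 - τ < κ ^ 2 := by
    rw [hκ2, lt_div_iff₀ hN2, hτ]
    field_simp
    nlinarith
  set t₀ : ℝ := -τ - 2 * κ ^ 2 with ht₀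
  -- the rescaled solution `v(s, y) = κ u(t₀ + κ² s, κ y)`
  set v : ℝ → (EuclideanSpace ℝ (Fin 3)) → (EuclideanSpace ℝ (Fin 3)) := κ • stPull (κ ^ 2) κ t₀ 0 u with hv
  have hcl' : IsClassicalNSSolutionOn ((fun r => t₀ + κ ^ 2 * r) ⁻¹' Iio 0) 1 0 v
      (κ ^ 2 • stPull (κ ^ 2) κ t₀ 0 p) := hcl.nsRescale_translate_zero hκpos t₀ 0
  have hwin_t : ∀ s ∈ Ioo (0 : ℝ) 2, t₀ + κ ^ 2 * s < -τ := by
    intro s hs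
    rw [ht₀]
    nlinarith [hs.2, sq_nonneg κ, hκpos]
  have hsub : Ioo (0 : ℝ) 2 ⊆ (fun r => t₀ + κ ^ 2 * r) ⁻¹' Iio 0 := fun s hs => by
    simp only [mem_preimage, mem_Iio]
    linarith [hwin_t s hs]
  have hclv : IsClassicalNSSolutionOn (Ioo (0 : ℝ) 2) 1 0 v (κ ^ 2 • stPull (κ ^ 2) κ t₀ 0 p) :=
    hcl'.mono hsub (uniqueDiffOn_Ioo 0 2)
  -- `|v| ≤ 1` on the window
  have hvb : ∀ s ∈ Ioo (0 : ℝ) 2, ∀ y, ‖v s y‖ ≤ 1 := by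
    intro s hs y
    have ht : t₀ + κ ^ 2 * s < 0 := by linarith [hwin_t s hs]
    have hτt : τ ≤ -(t₀ + κ ^ 2 * s) := by linarith [hwin_t s hs]
    have hsq : Real.sqrt τ ≤ Real.sqrt (-(t₀ + κ ^ 2 * s)) := Real.sqrt_le_sqrt hτt
    have hsτ : 0 < Real.sqrt τ := Real.sqrt_pos.2 hτpos
    rw [hv, smul_stPull_slice]
    simp only [zero_add]
    rw [norm_smul, Real.norm_of_nonneg hκpos.le]
    calc κ * ‖u (t₀ + κ ^ 2 * s) (κ • y)‖
        ≤ κ * (N / Real.sqrt (-(t₀ + κ ^ 2 * s))) :=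
          mul_le_mul_of_nonneg_left (hN _ ht _) hκpos.le
      _ ≤ κ * (N / Real.sqrt τ) := by
          gcongr
      _ = 1 := by
          rw [hκ]; field_simp
  have hweak : IsBoundedWeakNSSolutionOn (Ioo (0 : ℝ) 2) isOpen_Ioo 1 v :=
    hclv.isBoundedWeakNSSolutionOn ⟨1, hvb⟩
  obtain ⟨W, b, -, -, -, hae, hWs, -, hWC, -, -⟩ := hwin hweak hvb
  -- from almost every time to every time of `(1, 2)`, by continuity
  have hws : IsSmoothSpaceTimeOn (Ioo (0 : ℝ) 2) v := hclv.smooth_velocity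
  have hSU : UniqueDiffOn ℝ (Ioo (0 : ℝ) 2) := uniqueDiffOn_Ioo 0 2
  have hsub1 : Ioo (1 : ℝ) 2 ⊆ Ioo 0 2 := Ioo_subset_Ioo_left zero_le_one
  have hvx : ∀ s ∈ Ioo (0 : ℝ) 2, Continuous (v s) := fun s hs =>
    (hws.contDiff_slice hs).continuous
  have hgood : ∀ᵐ s ∂((volume : Measure ℝ).restrict (Ioo (0 : ℝ) 2)),
      s ∈ Ioo (0 : ℝ) 2 ∧ ∀ y, v s y = W s y + b s := by
    filter_upwards [hae, ae_restrict_mem measurableSet_Ioo] with s hs hsm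
    refine ⟨hsm, fun y => ?_⟩
    have hc2 : Continuous fun y => W s y + b s := (hWs s hsm).continuous.add continuous_const
    exact congr_fun ((Continuous.ae_eq_iff_eq volume (hvx s hsm) hc2).1 hs) y
  have hgood1 : ∀ᵐ s ∂((volume : Measure ℝ).restrict (Ioo (1 : ℝ) 2)),
      s ∈ Ioo (0 : ℝ) 2 ∧ ∀ y, v s y = W s y + b s :=
    ae_restrict_of_ae_restrict_of_subset hsub1 hgood
  have hsp : ∀ s₀ ∈ Ioo (1 : ℝ) 2, ∀ y, ‖fderiv ℝ (v s₀) y‖ ≤ Cw 1 1 := by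
    intro s₀ hs₀ y
    have hcont : ContinuousOn (fun s => ‖fderiv ℝ (v s) y‖) (Ioo 1 2) := by
      have h1 := (hws.continuousOn_fderiv_slice hSU).comp
        (continuousOn_id.prodMk continuousOn_const) (fun s hs => mk_mem_prod hs (mem_univ y))
      exact (h1.mono hsub1).norm
    refine ChaeWolf.le_of_ae_le_of_continuousOn hcont ?_ s₀ hs₀
    filter_upwards [hgood1, ae_restrict_mem measurableSet_Ioo] with s hs hs1
    have heq : v s = fun y => W s y + b s := funext hs.2
    rw [heq, fderiv_add_const, ← ChaeWolf.norm_iteratedFDeriv_one_eq_norm_fderiv]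
    exact hWC 1 one_pos 1 s hs1 y
  -- the time `s₁ ∈ (1, 2)` above `t = -1`
  set s₁ : ℝ := (-1 - t₀) / κ ^ 2 with hs₁
  have hκ20 : κ ^ 2 ≠ 0 := by positivity
  have hts₁ : t₀ + κ ^ 2 * s₁ = -1 := by
    rw [hs₁]; field_simp; ring
  have hs₁mem : s₁ ∈ Ioo (1 : ℝ) 2 := by
    rw [hs₁, ht₀, mem_Ioo, lt_div_iff₀ (by positivity), div_lt_iff₀ (by positivity)]
    constructor <;> nlinarith
  have hvs : v s₁ = fun y => κ • u (-1) (κ • y) := by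
    funext y
    rw [hv, smul_stPull_slice]
    simp only [zero_add, hts₁]
  -- undo the scaling: `Du(-1)(x) = κ⁻² Dv(s₁)(κ⁻¹ x)`
  have key : fderiv ℝ (v s₁) (κ⁻¹ • x) = (κ * κ) • fderiv ℝ (u (-1)) x := by
    rw [hvs, fderiv_const_smul_comp_smul' (u (-1)) κ κ (κ⁻¹ • x), smul_inv_smul₀ hκpos.ne']
  have hnorm : ‖fderiv ℝ (u (-1)) x‖ = (κ ^ 2)⁻¹ * ‖fderiv ℝ (v s₁) (κ⁻¹ • x)‖ := by
    rw [key, norm_smul, Real.norm_of_nonneg (mul_self_nonneg κ), ← sq, ← mul_assoc,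
      inv_mul_cancel₀ hκ20, one_mul]
  rw [hnorm, hκ2, inv_div]
  calc N ^ 2 / τ * ‖fderiv ℝ (v s₁) (κ⁻¹ • x)‖ ≤ N ^ 2 / τ * max (Cw 1 1) 0 :=
        mul_le_mul_of_nonneg_left ((hsp s₁ hs₁mem _).trans (le_max_left _ _)) (by positivity)
    _ ≤ N ^ 2 / (1 / 2) * max (Cw 1 1) 0 := by
        gcongr
    _ = 2 * max (Cw 1 1) 0 * N ^ 2 := by ring

/-! ### From a Pineau–Vicol profile to a classical solution on the past -/

/-- **From a Pineau–Vicol profile to a classical solution on the past.** A smooth divergence-free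
solution `(V, Q)` of the rotated profile system (1.8a) with rate `α` gives, through the ansatz
`u = pvAnsatz α V` (1.7), `u(t, x) = (−t)^{−1/2} R(αs) V(R(−αs) x/√(−t))`, `s = −log(−t)`, a
classical Navier–Stokes solution (`ν = 1`, no force) on the time set `(−∞, 0)`, with the pressure
`p(t, x) = (−t)⁻¹ Q(R(−αs) x/√(−t))` (the rotating profile solves the backward Leray system — tree:
`classicalOfProfile_isBackwardLeraySolutionOn` — and `isClassicalNSSolutionOn_Iio_ofLerayOrbit_iff`;
no bound on the pressure is needed). [cite: PineauVicol2026, (1.7)–(1.8) (arXiv:2607.09619 p. 3)] -/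
theorem isClassicalNSSolutionOn_pvAnsatz_of_profile {α : ℝ}
    {V : EuclideanSpace ℝ (Fin 3) → EuclideanSpace ℝ (Fin 3)} {Q : EuclideanSpace ℝ (Fin 3) → ℝ}
    (hV : ContDiff ℝ ∞ V) (hQ : ContDiff ℝ ∞ Q) (hdiv : VectorCalculus.IsDivFree V)
    (heq : ∀ y : EuclideanSpace ℝ (Fin 3), α • (rotGen (V y) - fderiv ℝ V y (rotGen y)) +
      (1 / 2 : ℝ) • V y + (1 / 2 : ℝ) • fderiv ℝ V y y - (Δ V) y + fderiv ℝ V y (V y) +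
      gradient Q y = 0) :
    IsClassicalNSSolutionOn (Iio 0) 1 0 (pvAnsatz α (fun y _ => V y))
      (ofLerayOrbitPressure fun (s : ℝ) (y : EuclideanSpace ℝ (Fin 3)) => Q (rotZ (-(α * s)) y)) := by
  have hL := classicalOfProfile_isBackwardLeraySolutionOn (α := α) hV hQ hdiv heq
  have hNS := isClassicalNSSolutionOn_Iio_ofLerayOrbit_iff.2 hL
  have e : pvAnsatz α (fun y _ => V y) = ofLerayOrbit
      (fun (s : ℝ) (y : EuclideanSpace ℝ (Fin 3)) => rotZ (α * s) (V (rotZ (-(α * s)) y))) := by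
    funext t x
    rfl
  rw [e]
  exact hNS

/-! ### Uniform gradient bound for Pineau–Vicol profiles -/

/-- **Uniform gradient bound for rotated self-similar profiles (any rotation rate).** There is an
absolute constant `C ≥ 0` such that every smooth divergence-free solution `(V, Q)` of Pineau–Vicol's
rotated Leray profile system `α(JV − DV[Jy]) + ½V + ½DV[y] − ΔV + DV[V] + ∇Q = 0` (ANY `α ∈ ℝ`)
with `sup |V| ≤ M` satisfies `‖DV(y)‖ ≤ C M²` at every point: the ansatz field
`u = pvAnsatz α V` is a classical solution on `(−∞, 0)` with `‖u(t, x)‖ ≤ M/√(−t)` and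
`u(−1, ·) = V`, so `exists_norm_fderiv_le_of_ancient_typeI` applies.  (Contrast: the
similarity-variable estimates in the tree give only polynomial growth of `DV`.)
[cite: PineauVicol2026, (1.7)–(1.8a) and Remark 1.2 (arXiv:2607.09619 p. 3)] -/
theorem exists_norm_fderiv_le_of_pvProfile :
    ∃ C : ℝ, 0 ≤ C ∧ ∀ {α : ℝ} {V : (EuclideanSpace ℝ (Fin 3)) → (EuclideanSpace ℝ (Fin 3))} {Q : (EuclideanSpace ℝ (Fin 3)) → ℝ},
      ContDiff ℝ ∞ V → ContDiff ℝ ∞ Q → VectorCalculus.IsDivFree V →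
      (∀ y, α • (rotGen (V y) - fderiv ℝ V y (rotGen y)) + (1 / 2 : ℝ) • V y
        + (1 / 2 : ℝ) • fderiv ℝ V y y - (Δ V) y + fderiv ℝ V y (V y) + gradient Q y = 0) →
      ∀ {M : ℝ}, (∀ y, ‖V y‖ ≤ M) → ∀ y, ‖fderiv ℝ V y‖ ≤ C * M ^ 2 := by
  obtain ⟨C, hC, h⟩ := exists_norm_fderiv_le_of_ancient_typeI
  refine ⟨C, hC, ?_⟩
  intro α V Q hV hQ hdiv heq M hM y
  have hNS := isClassicalNSSolutionOn_pvAnsatz_of_profile (α := α) hV hQ hdiv heq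
  have hbd : ∀ t < (0 : ℝ), ∀ x, ‖pvAnsatz α (fun y _ => V y) t x‖ ≤ M / Real.sqrt (-t) := by
    intro t ht x
    rw [norm_pvAnsatz, div_eq_inv_mul]
    exact mul_le_mul_of_nonneg_left (hM _) (inv_nonneg.2 (Real.sqrt_nonneg _))
  have key := h hNS hbd y
  have e1 : pvAnsatz α (fun y _ => V y) (-1) = V := funext fun x => pvAnsatz_neg_one α _ x
  rwa [e1] at key

end Summit.NavierStokesRegularity.NavierStokesRegularity.Theorems.CoriolisHead

end
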